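import Mathlib
import HarnessLib
import Summits.AtomisticToContinuum.Crystallization.Theorems.PricedLinkCensusSoftFourRingsCube2
import Summits.AtomisticToContinuum.Crystallization.Theorems.PricedLinkCensusSoftFourRingsHexagon2

/-!
# Soft four-rings, endgame: the second bonds of the frame (cuboctahedral branch)

Support file for `SoftFourRings` (route `PricedLinkCensus`, sub-problem `Crystallization`),
endgame step (E5) of the evidence file (§12.8), point-level form, every vertex of type O.  In the
frame of `cube_frame` (`N(a) = {v, b, x, a'}`, `N(b) = {v, a, y, b'}`, `N(c) = {v, d, x, c'}`,
`N(d) = {v, c, y, d'}`, `N(x) = {a, a', c, c'}`, `N(y) = {b, b', d, d'}`):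

* `frame_ne` — `a' ≠ d'` (else the eight points `v, a, b, c, d, x, y, a'` would be saturated by
  ten, `saturated_eight_false`);
* `cube_pairing` — **`a' ∼ b'`** (the cells at `a`; the alternative pairings are excluded by
  `frame_ne` and by `hα` at `v`).

Applied a second time with `(a, b, a', b')` and `(c, d, c', d')` exchanged this also gives
`c' ≠ b'` and `c' ∼ d'`.
-/

namespace Summit.AtomisticToContinuum.Crystallization.Theorems

open Real RealInnerProductSpace Literature.Geometry.DiscreteGeometry

section Setting

variable {X : Finset (EuclideanSpace ℝ (Fin 3))} {B : Finset (Finset (EuclideanSpace ℝ (Fin 3)))}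
  (hT : musinTarasov2012_tammes_thirteen) (hX1 : ∀ y ∈ X, ‖y‖ = 1) (hcard : X.card = 12)
  (hsepX : ∀ u ∈ X, ∀ u' ∈ X, u ≠ u' → ⟪u, u'⟫ ≤ 1 - 1 / (2 * (101 / 100 : ℝ) ^ 2))
  (hB : ∀ T ∈ B, ∃ u ∈ X, ∃ u' ∈ X, u ≠ u' ∧ 1 - (101 / 100 : ℝ) ^ 2 / 2 ≤ ⟪u, u'⟫ ∧ T = {u, u'})
  (hBcard : B.card = 24)
  (hdeg : ∀ v ∈ X, ∃ w : Fin 4 → EuclideanSpace ℝ (Fin 3), (∀ k, w k ∈ X) ∧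
    Function.Injective w ∧ (∀ k, w k ≠ v) ∧
    (∀ k, ({v, w k} : Finset (EuclideanSpace ℝ (Fin 3))) ∈ B) ∧
    ∀ y, ({v, y} : Finset (EuclideanSpace ℝ (Fin 3))) ∈ B → ∃ k, y = w k)
  (hallO : ∀ u ∈ X, ∃ a b c d : EuclideanSpace ℝ (Fin 3), (∀ t, ({u, t} : Finset (EuclideanSpace ℝ (Fin 3))) ∈ B ↔ (t = a ∨ t = b ∨ t = c ∨ t = d)) ∧ (a ≠ b ∧ a ≠ c ∧ a ≠ d ∧ b ≠ c ∧ b ≠ d ∧ c ≠ d) ∧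
    ({a, b} : Finset (EuclideanSpace ℝ (Fin 3))) ∈ B ∧ ({c, d} : Finset (EuclideanSpace ℝ (Fin 3))) ∈ B ∧ ({a, c} : Finset (EuclideanSpace ℝ (Fin 3))) ∉ B ∧ ({a, d} : Finset (EuclideanSpace ℝ (Fin 3))) ∉ B ∧ ({b, c} : Finset (EuclideanSpace ℝ (Fin 3))) ∉ B ∧ ({b, d} : Finset (EuclideanSpace ℝ (Fin 3))) ∉ B)

include hcard hB hdeg hallO in
/-- **`a' ≠ d'` in the frame.** -/
theorem frame_ne {v a b c d x y a' b' c' d' : EuclideanSpace ℝ (Fin 3)} (hv : v ∈ X)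
    (hN : (∀ t, ({v, t} : Finset (EuclideanSpace ℝ (Fin 3))) ∈ B ↔ (t = a ∨ t = b ∨ t = c ∨ t = d))) (hd : (a ≠ b ∧ a ≠ c ∧ a ≠ d ∧ b ≠ c ∧ b ≠ d ∧ c ≠ d)) (hab : ({a, b} : Finset (EuclideanSpace ℝ (Fin 3))) ∈ B) (hcd : ({c, d} : Finset (EuclideanSpace ℝ (Fin 3))) ∈ B)
    (hac : ({a, c} : Finset (EuclideanSpace ℝ (Fin 3))) ∉ B) (had : ({a, d} : Finset (EuclideanSpace ℝ (Fin 3))) ∉ B) (hbc : ({b, c} : Finset (EuclideanSpace ℝ (Fin 3))) ∉ B) (hbd : ({b, d} : Finset (EuclideanSpace ℝ (Fin 3))) ∉ B)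
    (hNa : (∀ t, ({a, t} : Finset (EuclideanSpace ℝ (Fin 3))) ∈ B ↔ (t = v ∨ t = b ∨ t = x ∨ t = a'))) (hda : (v ≠ b ∧ v ≠ x ∧ v ≠ a' ∧ b ≠ x ∧ b ≠ a' ∧ x ≠ a')) (hxa' : ({x, a'} : Finset (EuclideanSpace ℝ (Fin 3))) ∈ B)
    (hvxn : ({v, x} : Finset (EuclideanSpace ℝ (Fin 3))) ∉ B) (hvapn : ({v, a'} : Finset (EuclideanSpace ℝ (Fin 3))) ∉ B) (hbxn : ({b, x} : Finset (EuclideanSpace ℝ (Fin 3))) ∉ B) (hbapn : ({b, a'} : Finset (EuclideanSpace ℝ (Fin 3))) ∉ B)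
    (hNb : (∀ t, ({b, t} : Finset (EuclideanSpace ℝ (Fin 3))) ∈ B ↔ (t = v ∨ t = a ∨ t = y ∨ t = b'))) (hdb : (v ≠ a ∧ v ≠ y ∧ v ≠ b' ∧ a ≠ y ∧ a ≠ b' ∧ y ≠ b')) (hyb' : ({y, b'} : Finset (EuclideanSpace ℝ (Fin 3))) ∈ B)
    (hvyn : ({v, y} : Finset (EuclideanSpace ℝ (Fin 3))) ∉ B) (hvbpn : ({v, b'} : Finset (EuclideanSpace ℝ (Fin 3))) ∉ B) (hayn : ({a, y} : Finset (EuclideanSpace ℝ (Fin 3))) ∉ B) (habpn : ({a, b'} : Finset (EuclideanSpace ℝ (Fin 3))) ∉ B)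
    (hNc : (∀ t, ({c, t} : Finset (EuclideanSpace ℝ (Fin 3))) ∈ B ↔ (t = v ∨ t = d ∨ t = x ∨ t = c'))) (hdc : (v ≠ d ∧ v ≠ x ∧ v ≠ c' ∧ d ≠ x ∧ d ≠ c' ∧ x ≠ c')) (hxc' : ({x, c'} : Finset (EuclideanSpace ℝ (Fin 3))) ∈ B)
    (hvcpn : ({v, c'} : Finset (EuclideanSpace ℝ (Fin 3))) ∉ B) (hdxn : ({d, x} : Finset (EuclideanSpace ℝ (Fin 3))) ∉ B) (hdcpn : ({d, c'} : Finset (EuclideanSpace ℝ (Fin 3))) ∉ B)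
    (hNd : (∀ t, ({d, t} : Finset (EuclideanSpace ℝ (Fin 3))) ∈ B ↔ (t = v ∨ t = c ∨ t = y ∨ t = d'))) (hdd : (v ≠ c ∧ v ≠ y ∧ v ≠ d' ∧ c ≠ y ∧ c ≠ d' ∧ y ≠ d')) (hyd' : ({y, d'} : Finset (EuclideanSpace ℝ (Fin 3))) ∈ B)
    (hvdpn : ({v, d'} : Finset (EuclideanSpace ℝ (Fin 3))) ∉ B) (hcyn : ({c, y} : Finset (EuclideanSpace ℝ (Fin 3))) ∉ B) (hcdpn : ({c, d'} : Finset (EuclideanSpace ℝ (Fin 3))) ∉ B)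
    (hNx : (∀ t, ({x, t} : Finset (EuclideanSpace ℝ (Fin 3))) ∈ B ↔ (t = a ∨ t = a' ∨ t = c ∨ t = c'))) (hdxx : (a ≠ a' ∧ a ≠ c ∧ a ≠ c' ∧ a' ≠ c ∧ a' ≠ c' ∧ c ≠ c'))
    (hacpn : ({a, c'} : Finset (EuclideanSpace ℝ (Fin 3))) ∉ B) (hapcn : ({a', c} : Finset (EuclideanSpace ℝ (Fin 3))) ∉ B) (hapcpn : ({a', c'} : Finset (EuclideanSpace ℝ (Fin 3))) ∉ B)
    (hNy : (∀ t, ({y, t} : Finset (EuclideanSpace ℝ (Fin 3))) ∈ B ↔ (t = b ∨ t = b' ∨ t = d ∨ t = d'))) (hdyy : (b ≠ b' ∧ b ≠ d ∧ b ≠ d' ∧ b' ≠ d ∧ b' ≠ d' ∧ d ≠ d'))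
    (hbdpn : ({b, d'} : Finset (EuclideanSpace ℝ (Fin 3))) ∉ B) (hbpdn : ({b', d} : Finset (EuclideanSpace ℝ (Fin 3))) ∉ B) (hbpdpn : ({b', d'} : Finset (EuclideanSpace ℝ (Fin 3))) ∉ B)
    (hxX : x ∈ X) (hyX : y ∈ X) (hxv : x ≠ v) (hxa : x ≠ a) (hxb : x ≠ b) (hxc : x ≠ c) (hxd : x ≠ d)
    (hyv : y ≠ v) (hya : y ≠ a) (hyb : y ≠ b) (hyc : y ≠ c) (hyd : y ≠ d) (hxy : x ≠ y) :
    a' ≠ d' := by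
  intro heq
  have hva : ({v, a} : Finset (EuclideanSpace ℝ (Fin 3))) ∈ B := (hN a).2 (Or.inl rfl)
  have hvb : ({v, b} : Finset (EuclideanSpace ℝ (Fin 3))) ∈ B := (hN b).2 (Or.inr (Or.inl rfl))
  have hvc : ({v, c} : Finset (EuclideanSpace ℝ (Fin 3))) ∈ B := (hN c).2 (Or.inr (Or.inr (Or.inl rfl)))
  have hvd : ({v, d} : Finset (EuclideanSpace ℝ (Fin 3))) ∈ B := (hN d).2 (Or.inr (Or.inr (Or.inr rfl)))
  have haa' : ({a, a'} : Finset (EuclideanSpace ℝ (Fin 3))) ∈ B := (hNa a').2 (Or.inr (Or.inr (Or.inr rfl)))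
  have hax : ({a, x} : Finset (EuclideanSpace ℝ (Fin 3))) ∈ B := (hNa x).2 (Or.inr (Or.inr (Or.inl rfl)))
  have hbb' : ({b, b'} : Finset (EuclideanSpace ℝ (Fin 3))) ∈ B := (hNb b').2 (Or.inr (Or.inr (Or.inr rfl)))
  have hcc' : ({c, c'} : Finset (EuclideanSpace ℝ (Fin 3))) ∈ B := (hNc c').2 (Or.inr (Or.inr (Or.inr rfl)))
  have hdd' : ({d, d'} : Finset (EuclideanSpace ℝ (Fin 3))) ∈ B := (hNd d').2 (Or.inr (Or.inr (Or.inr rfl)))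
  have hbX : b ∈ X := (mem_of_mem_bonds hB hvb).2
  have haX : a ∈ X := (mem_of_mem_bonds hB hva).2
  have hcX : c ∈ X := (mem_of_mem_bonds hB hvc).2
  have hdX : d ∈ X := (mem_of_mem_bonds hB hvd).2
  have ha'X : a' ∈ X := (mem_of_mem_bonds hB haa').2
  have hb'X : b' ∈ X := (mem_of_mem_bonds hB hbb').2
  have hc'X : c' ∈ X := (mem_of_mem_bonds hB hcc').2
  -- the bonds of `a'` are `a, x, d, y`
  rw [← heq] at hdd' hyd' hNd hNy
  obtain ⟨p, q, r, s, hN', hd', hB1, hB2, hn1, hn2, hn3, hn4⟩ := hallO a' ha'X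
  obtain ⟨t', hNa', -, -, -, -, -, -, -⟩ :=
    typeO_complete hN' hd' hB1 hB2 hn1 hn2 hn3 hn4 hax (by rw [Finset.pair_comm]; exact haa')
      (by rw [Finset.pair_comm]; exact hxa') hxa.symm (by rw [Finset.pair_comm]; exact hdd')
      hd.2.2.1.symm hxd.symm
  have hyt : y = t' := by
    rcases (hNa' y).1 (by rw [Finset.pair_comm]; exact hyd') with h | h | h | h
    exacts [absurd h hya, absurd h hxy.symm, absurd h hyd, h]
  -- saturated eight points
  have ha'v : a' ≠ v := hda.2.2.1.symm
  have ha'b : a' ≠ b := hda.2.2.2.2.1.symm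
  have ha'x : a' ≠ x := hda.2.2.2.2.2.symm
  have ha'a : a' ≠ a := (ne_of_mem_bonds hB haa').symm
  have ha'c : a' ≠ c := hdxx.2.2.2.1
  have ha'd : a' ≠ d := fun h => had (h ▸ haa')
  have ha'y : a' ≠ y := fun h => hayn (h ▸ haa')
  have hva' : v ≠ a := ne_of_mem_bonds hB hva
  have hvb' : v ≠ b := ne_of_mem_bonds hB hvb
  have hvc' : v ≠ c := ne_of_mem_bonds hB hvc
  have hvd' : v ≠ d := ne_of_mem_bonds hB hvd
  classical
  set S : Finset (EuclideanSpace ℝ (Fin 3)) := {v, a, b, c, d, x, y, a'} with hS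
  set T : Finset (EuclideanSpace ℝ (Fin 3)) := insert b' (insert c' S) with hT'
  have hSX : S ⊆ X := by
    intro u hu
    simp only [hS, Finset.mem_insert, Finset.mem_singleton] at hu
    rcases hu with rfl | rfl | rfl | rfl | rfl | rfl | rfl | rfl
    exacts [hv, haX, hbX, hcX, hdX, hxX, hyX, ha'X]
  have hST : S ⊆ T := fun u hu => by
    rw [hT']; exact Finset.mem_insert_of_mem (Finset.mem_insert_of_mem hu)
  have hTX : T ⊆ X := by
    intro u hu
    rw [hT', Finset.mem_insert, Finset.mem_insert] at hu
    rcases hu with rfl | rfl | hu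
    exacts [hb'X, hc'X, hSX hu]
  have hS8 : S.card = 8 := by
    rw [hS, Finset.card_insert_of_notMem, Finset.card_insert_of_notMem,
      Finset.card_insert_of_notMem, Finset.card_insert_of_notMem, Finset.card_insert_of_notMem,
      Finset.card_insert_of_notMem, Finset.card_pair ha'y.symm]
    all_goals simp only [Finset.mem_insert, Finset.mem_singleton, not_or]
    · exact ⟨hxy, ha'x.symm⟩
    · exact ⟨hxd.symm, hyd.symm, ha'd.symm⟩
    · exact ⟨hd.2.2.2.2.2, hxc.symm, hyc.symm, ha'c.symm⟩
    · exact ⟨hd.2.2.2.1, hd.2.2.2.2.1, hxb.symm, hyb.symm, ha'b.symm⟩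
    · exact ⟨hd.1, hd.2.1, hd.2.2.1, hxa.symm, hya.symm, ha'a.symm⟩
    · exact ⟨hva', hvb', hvc', hvd', hxv.symm, hyv.symm, ha'v.symm⟩
  have hT10 : T.card ≤ 10 := by
    rw [hT']
    refine (Finset.card_insert_le _ _).trans ?_
    have := Finset.card_insert_le c' S
    omega
  refine saturated_eight_false hcard hdeg hSX hS8 hST hTX hT10 ?_
  have memS : ∀ {u : EuclideanSpace ℝ (Fin 3)}, u = v ∨ u = a ∨ u = b ∨ u = c ∨ u = d ∨ u = x ∨ u = y ∨ u = a' → u ∈ T := by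
    intro u hu
    apply hST
    simp only [hS, Finset.mem_insert, Finset.mem_singleton]
    exact hu
  have memb' : b' ∈ T := by rw [hT']; exact Finset.mem_insert_self _ _
  have memc' : c' ∈ T := by
    rw [hT']; exact Finset.mem_insert_of_mem (Finset.mem_insert_self _ _)
  intro u hu z hz
  simp only [hS, Finset.mem_insert, Finset.mem_singleton] at hu
  rcases hu with rfl | rfl | rfl | rfl | rfl | rfl | rfl | rfl
  · rcases (hN z).1 hz with h | h | h | h <;> apply memS <;> simp [h]
  · rcases (hNa z).1 hz with h | h | h | h <;> apply memS <;> simp [h]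
  · rcases (hNb z).1 hz with h | h | h | h
    · apply memS; simp [h]
    · apply memS; simp [h]
    · apply memS; simp [h]
    · rw [h]; exact memb'
  · rcases (hNc z).1 hz with h | h | h | h
    · apply memS; simp [h]
    · apply memS; simp [h]
    · apply memS; simp [h]
    · rw [h]; exact memc'
  · rcases (hNd z).1 hz with h | h | h | h <;> apply memS <;> simp [h]
  · rcases (hNx z).1 hz with h | h | h | h
    · apply memS; simp [h]
    · apply memS; simp [h]
    · apply memS; simp [h]
    · rw [h]; exact memc'
  · rcases (hNy z).1 hz with h | h | h | h
    · apply memS; simp [h]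
    · rw [h]; exact memb'
    · apply memS; simp [h]
    · apply memS; simp [h]
  · rcases (hNa' z).1 hz with h | h | h | h
    · apply memS; simp [h]
    · apply memS; simp [h]
    · apply memS; simp [h]
    · rw [h, ← hyt]; apply memS; simp

include hT hX1 hcard hsepX hB hBcard hdeg hallO in
open scoped Classical in
/-- **The second bond at the wing `a` of the frame: `a' ∼ b'`.** -/
theorem cube_pairing {v a b c d x y a' b' c' d' : EuclideanSpace ℝ (Fin 3)} (hv : v ∈ X)
    (hN : (∀ t, ({v, t} : Finset (EuclideanSpace ℝ (Fin 3))) ∈ B ↔ (t = a ∨ t = b ∨ t = c ∨ t = d))) (hd : (a ≠ b ∧ a ≠ c ∧ a ≠ d ∧ b ≠ c ∧ b ≠ d ∧ c ≠ d)) (hab : ({a, b} : Finset (EuclideanSpace ℝ (Fin 3))) ∈ B) (hcd : ({c, d} : Finset (EuclideanSpace ℝ (Fin 3))) ∈ B)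
    (hac : ({a, c} : Finset (EuclideanSpace ℝ (Fin 3))) ∉ B) (had : ({a, d} : Finset (EuclideanSpace ℝ (Fin 3))) ∉ B) (hbc : ({b, c} : Finset (EuclideanSpace ℝ (Fin 3))) ∉ B) (hbd : ({b, d} : Finset (EuclideanSpace ℝ (Fin 3))) ∉ B)
    (hNa : (∀ t, ({a, t} : Finset (EuclideanSpace ℝ (Fin 3))) ∈ B ↔ (t = v ∨ t = b ∨ t = x ∨ t = a'))) (hda : (v ≠ b ∧ v ≠ x ∧ v ≠ a' ∧ b ≠ x ∧ b ≠ a' ∧ x ≠ a')) (hxa' : ({x, a'} : Finset (EuclideanSpace ℝ (Fin 3))) ∈ B)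
    (hvxn : ({v, x} : Finset (EuclideanSpace ℝ (Fin 3))) ∉ B) (hvapn : ({v, a'} : Finset (EuclideanSpace ℝ (Fin 3))) ∉ B) (hbxn : ({b, x} : Finset (EuclideanSpace ℝ (Fin 3))) ∉ B) (hbapn : ({b, a'} : Finset (EuclideanSpace ℝ (Fin 3))) ∉ B)
    (hNb : (∀ t, ({b, t} : Finset (EuclideanSpace ℝ (Fin 3))) ∈ B ↔ (t = v ∨ t = a ∨ t = y ∨ t = b'))) (hdb : (v ≠ a ∧ v ≠ y ∧ v ≠ b' ∧ a ≠ y ∧ a ≠ b' ∧ y ≠ b')) (hyb' : ({y, b'} : Finset (EuclideanSpace ℝ (Fin 3))) ∈ B)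
    (hvyn : ({v, y} : Finset (EuclideanSpace ℝ (Fin 3))) ∉ B) (hvbpn : ({v, b'} : Finset (EuclideanSpace ℝ (Fin 3))) ∉ B) (hayn : ({a, y} : Finset (EuclideanSpace ℝ (Fin 3))) ∉ B) (habpn : ({a, b'} : Finset (EuclideanSpace ℝ (Fin 3))) ∉ B)
    (hNc : (∀ t, ({c, t} : Finset (EuclideanSpace ℝ (Fin 3))) ∈ B ↔ (t = v ∨ t = d ∨ t = x ∨ t = c'))) (hdc : (v ≠ d ∧ v ≠ x ∧ v ≠ c' ∧ d ≠ x ∧ d ≠ c' ∧ x ≠ c')) (hxc' : ({x, c'} : Finset (EuclideanSpace ℝ (Fin 3))) ∈ B)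
    (hvcpn : ({v, c'} : Finset (EuclideanSpace ℝ (Fin 3))) ∉ B) (hdxn : ({d, x} : Finset (EuclideanSpace ℝ (Fin 3))) ∉ B) (hdcpn : ({d, c'} : Finset (EuclideanSpace ℝ (Fin 3))) ∉ B)
    (hNd : (∀ t, ({d, t} : Finset (EuclideanSpace ℝ (Fin 3))) ∈ B ↔ (t = v ∨ t = c ∨ t = y ∨ t = d'))) (hdd : (v ≠ c ∧ v ≠ y ∧ v ≠ d' ∧ c ≠ y ∧ c ≠ d' ∧ y ≠ d')) (hyd' : ({y, d'} : Finset (EuclideanSpace ℝ (Fin 3))) ∈ B)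
    (hvdpn : ({v, d'} : Finset (EuclideanSpace ℝ (Fin 3))) ∉ B) (hcyn : ({c, y} : Finset (EuclideanSpace ℝ (Fin 3))) ∉ B) (hcdpn : ({c, d'} : Finset (EuclideanSpace ℝ (Fin 3))) ∉ B)
    (hNx : (∀ t, ({x, t} : Finset (EuclideanSpace ℝ (Fin 3))) ∈ B ↔ (t = a ∨ t = a' ∨ t = c ∨ t = c'))) (hdxx : (a ≠ a' ∧ a ≠ c ∧ a ≠ c' ∧ a' ≠ c ∧ a' ≠ c' ∧ c ≠ c'))
    (hacpn : ({a, c'} : Finset (EuclideanSpace ℝ (Fin 3))) ∉ B) (hapcn : ({a', c} : Finset (EuclideanSpace ℝ (Fin 3))) ∉ B) (hapcpn : ({a', c'} : Finset (EuclideanSpace ℝ (Fin 3))) ∉ B)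
    (hNy : (∀ t, ({y, t} : Finset (EuclideanSpace ℝ (Fin 3))) ∈ B ↔ (t = b ∨ t = b' ∨ t = d ∨ t = d'))) (hdyy : (b ≠ b' ∧ b ≠ d ∧ b ≠ d' ∧ b' ≠ d ∧ b' ≠ d' ∧ d ≠ d'))
    (hbdpn : ({b, d'} : Finset (EuclideanSpace ℝ (Fin 3))) ∉ B) (hbpdn : ({b', d} : Finset (EuclideanSpace ℝ (Fin 3))) ∉ B) (hbpdpn : ({b', d'} : Finset (EuclideanSpace ℝ (Fin 3))) ∉ B)
    (hxX : x ∈ X) (hyX : y ∈ X) (hxv : x ≠ v) (hxa : x ≠ a) (hxb : x ≠ b) (hxc : x ≠ c) (hxd : x ≠ d)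
    (hyv : y ≠ v) (hya : y ≠ a) (hyb : y ≠ b) (hyc : y ≠ c) (hyd : y ≠ d) (hxy : x ≠ y) :
    ({a', b'} : Finset (EuclideanSpace ℝ (Fin 3))) ∈ B := by
  have ha'd' := frame_ne hcard hB hdeg hallO hv hN hd hab hcd hac had hbc hbd hNa hda hxa' hvxn hvapn
    hbxn hbapn hNb hdb hyb' hvyn hvbpn hayn habpn hNc hdc hxc' hvcpn hdxn hdcpn hNd hdd hyd' hvdpn hcyn
    hcdpn hNx hdxx hacpn hapcn hapcpn hNy hdyy hbdpn hbpdn hbpdpn hxX hyX hxv hxa hxb hxc hxd hyv hya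
    hyb hyc hyd hxy
  have hva : ({v, a} : Finset (EuclideanSpace ℝ (Fin 3))) ∈ B := (hN a).2 (Or.inl rfl)
  have hvb : ({v, b} : Finset (EuclideanSpace ℝ (Fin 3))) ∈ B := (hN b).2 (Or.inr (Or.inl rfl))
  have haa' : ({a, a'} : Finset (EuclideanSpace ℝ (Fin 3))) ∈ B := (hNa a').2 (Or.inr (Or.inr (Or.inr rfl)))
  have haX : a ∈ X := (mem_of_mem_bonds hB hva).2
  -- `hα` at `v` for the pair `{a, b}` and at `a` for the pair `{v, b}`
  have hαv := alpha_of_allO hB hallO hva hvb hab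
  have hαa : ∀ z, ({z, v} : Finset (EuclideanSpace ℝ (Fin 3))) ∈ B → ({z, b} : Finset (EuclideanSpace ℝ (Fin 3))) ∈ B → z = a := fun z h1 h2 =>
    alpha_of_typeO hN hd hac had hbc hbd (by rw [Finset.pair_comm]; exact hva) hab hd.1 hvb h1 h2
      (ne_of_mem_bonds hB h2)
  have ha'b : a' ≠ b := hda.2.2.2.2.1.symm
  have ha'd : a' ≠ d := fun h => had (h ▸ haa')
  -- the cells at `a`
  rcases typeO_cells hT hX1 hcard hsepX hB hBcard hdeg haX hNa hda hvb hxa' hvxn hvapn hbxn hbapn hαa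
    with ⟨-, ⟨w, -, hwa, hwv, hwb, hwx, hwa', hB1, hB2⟩⟩ | ⟨⟨w, -, hwa, hwv, hwb, hwx, hwa', hB1, hB2⟩, -⟩
  · -- `w ∼ b`, `w ∼ a'`: `w = b'` (and `w = y` would put `a'` into `N(y)`)
    rcases (hNb w).1 (by rw [Finset.pair_comm]; exact hB1) with h | h | h | h
    · exact absurd h hwv
    · exact absurd h hwa
    · exfalso
      rw [h] at hB2
      rcases (hNy a').1 hB2 with e | e | e | e
      · exact ha'b e
      · exact habpn (e ▸ haa')
      · exact ha'd e
      · exact ha'd' e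
    · rw [h] at hB2; rw [Finset.pair_comm]; exact hB2
  · -- `w ∼ v`, `w ∼ a'`: `w ∈ {c, d}`, impossible
    exfalso
    rcases (hN w).1 (by rw [Finset.pair_comm]; exact hB1) with h | h | h | h
    · exact hwa h
    · exact hwb h
    · rw [h] at hB2
      rcases (hNc a').1 hB2 with e | e | e | e
      · exact hda.2.2.1 e.symm
      · exact ha'd e
      · exact hda.2.2.2.2.2 e.symm
      · exact hdxx.2.2.2.2.1 e
    · rw [h] at hB2
      rcases (hNd a').1 hB2 with e | e | e | e
      · exact hda.2.2.1 e.symm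
      · exact hdxx.2.2.2.1 e
      · exact hayn (e ▸ haa')
      · exact ha'd' e

end Setting

end Summit.AtomisticToContinuum.Crystallization.Theorems
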